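import Literature.MathematicalPhysics.KineticTheory.LangevinChainSDE
import HarnessLib

/-!
# Two-sided energy bounds and increment estimates along the flow of the pinned chain

Trunk T-KINETIC (Literature/MathematicalPhysics/KineticTheory). Deterministic (pathwise) estimates
for the flow `z = OscillatorChain.chainFlow x η` of the pinned anharmonic chain driven by a
continuous momentum-noise path `η` (`LangevinChainSDE.lean`; Cuneo–Eckmann–Hairer–Rey-Bellet 2018,
eq. (2.2) in integral form), used in the one-step generator estimate behind the Dynkin identity of
its transition semigroup (provefact unit `CuneoEckmannHairerReyBellet2018_pinnedChain`):

* `OscillatorChain.hamiltonian_add_momentum`, `OscillatorChain.drift_add_momentum` — the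
  Hamiltonian is quadratic and the drift `Y(q,p) = (p, -∇Φ(q) - γ1_B p)` is AFFINE in the momenta:
  `H(q, p+e) = H(q,p) + ∑(p_i e_i + e_i²/2) ≥ H(q,p) - ‖e‖∑|p_i|`,
  `Y(q, p+e) = Y(q,p) + (e, -γ w e)`, `‖Y(q,p+e) - Y(q,p)‖ ≤ (1 + 2|γ|)‖e‖`.
* `OscillatorChain.neg_fderiv_hamiltonian_drift_le`, `pinnedChain_neg_fderiv_hamiltonian_drift_le` —
  the LOWER energy identity `-DH(y)·Y(y + (0,e)) ≤ ‖e‖(∑|∂_qH| + 2γ∑|p|) + 2γ∑p² ≤ (C‖e‖ + 4γ)(1+H)`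
  (the companion of `fderiv_hamiltonian_drift_le` of `LangevinChainSDE.lean`; CEHR (3.3) reads
  `LH = γ∑_b(T_b - p_b²)`, here pathwise with the noise momentum `e` in place of Itô's correction).
* `pinnedChain_le_hamiltonian_chainFlow` / `pinnedChain_hamiltonian_chainFlow_le` — **two-sided
  Grönwall**: `(1 + H(x))e^{-(CM+4γ)t} ≤ 1 + H(z(t) - (0,η(t))) ≤ (1 + H(x))e^{CMt}` on `[0,T]`
  when `‖η‖ ≤ M` there (`C = pinnedChainEnergyConst`).
* `pinnedChain_flow_local_bounds` — below an energy level `E₀`: a common radius `R₀`, drift bound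
  `Y₁` and Lipschitz constant `L₁` with `‖z(t)‖ ≤ R₀`, `‖D(t)‖ ≤ tY₁` and
  `‖D(t) - tY(x)‖ ≤ L₁ t (M + T Y₁)` for the drift increment `D(t) = z(t) - x - (0,η(t)) = ∫₀ᵗ Y(z)`
  (`‖η‖ ≤ M ≤ 1` on `[0,T]`, `T ≤ 1`).
* `pinnedChain_flow_far` — **the far region**: above a level `E₁(E_K)` the flow stays strictly
  above the level `E_K` on `[0, T]` (`‖η‖ ≤ M ≤ 1/2`, `T ≤ 1`): a test function supported in
  `{H ≤ E_K}` does not see such trajectories.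

## References

* N. Cuneo, J.-P. Eckmann, M. Hairer, L. Rey-Bellet, EJP 23 (2018) no. 55 (arXiv:1712.09413),
  §2 eq. (2.2), §3 eq. (3.3) and p. 7.
* R. Khasminskii, *Stochastic Stability of Differential Equations* (2nd ed., 2012), §3.4 and
  Thm 3.5 (energy/Lyapunov control of SDE solutions).
-/

noncomputable section

open MeasureTheory Filter Topology Set Metric
open scoped NNReal

namespace Literature.MathematicalPhysics.KineticTheory.HeatConduction

open OscillatorChain

variable {N : ℕ}

/-! ### Momentum perturbations of the Hamiltonian and of the drift -/

namespace OscillatorChain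

variable (P : OscillatorChain)

/-- `H(q, p + e) = H(q, p) + ∑_i (p_i e_i + e_i²/2)`: the potential energy does not see the
momenta. [folklore] -/
theorem hamiltonian_add_momentum (N : ℕ) (y : PhaseSpace N) (e : Fin N → ℝ) :
    P.hamiltonian N (y.1, y.2 + e) = P.hamiltonian N y + ∑ i, (y.2 i * e i + e i ^ 2 / 2) := by
  rw [P.hamiltonian_eq_kinetic_add_potential, P.hamiltonian_eq_kinetic_add_potential,
    add_right_comm, ← Finset.sum_add_distrib]
  congr 1
  refine Finset.sum_congr rfl fun i _ => ?_
  simp only [Pi.add_apply]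
  ring

/-- `H(q, p + e) ≥ H(q, p) - ‖e‖ ∑_i |p_i|`. [folklore] -/
theorem hamiltonian_sub_le_hamiltonian_add_momentum (N : ℕ) (y : PhaseSpace N) (e : Fin N → ℝ) :
    P.hamiltonian N y - ‖e‖ * ∑ i, |y.2 i| ≤ P.hamiltonian N (y.1, y.2 + e) := by
  rw [P.hamiltonian_add_momentum, Finset.mul_sum]
  have h : ∀ i, -(‖e‖ * |y.2 i|) ≤ y.2 i * e i + e i ^ 2 / 2 := fun i => by
    have he : |e i| ≤ ‖e‖ := by rw [← Real.norm_eq_abs]; exact norm_le_pi_norm e i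
    have h1 : -(‖e‖ * |y.2 i|) ≤ y.2 i * e i := by
      calc -(‖e‖ * |y.2 i|) ≤ -(|e i| * |y.2 i|) := by
            exact neg_le_neg (mul_le_mul_of_nonneg_right he (abs_nonneg _))
        _ = -|y.2 i * e i| := by rw [abs_mul, mul_comm]
        _ ≤ y.2 i * e i := neg_abs_le _
    nlinarith [sq_nonneg (e i)]
  have := Finset.sum_le_sum fun i (_ : i ∈ Finset.univ) => h i
  rw [Finset.sum_neg_distrib] at this
  linarith

/-- **The drift is affine in the momenta**: `Y(q, p + e) = Y(q, p) + (e, -γ w e)` with the bath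
weights `w_i = [i=0] + [i=N-1]`. [folklore] -/
theorem drift_add_momentum (N : ℕ) (y : PhaseSpace N) (e : Fin N → ℝ) :
    P.drift N (y.1, y.2 + e) = P.drift N y + (e, fun i => -(P.γ * bathWeight N i * e i)) := by
  unfold drift
  ext i
  · simp
  · simp only [P.partialQ_hamiltonian_fst, Pi.add_apply, Prod.snd_add]
    ring

/-- `‖Y(q, p + e) - Y(q, p)‖ ≤ (1 + 2|γ|) ‖e‖`. [folklore] -/
theorem norm_drift_add_momentum_sub_le (N : ℕ) (y : PhaseSpace N) (e : Fin N → ℝ) :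
    ‖P.drift N (y.1, y.2 + e) - P.drift N y‖ ≤ (1 + 2 * |P.γ|) * ‖e‖ := by
  rw [P.drift_add_momentum, add_sub_cancel_left, Prod.norm_def]
  refine max_le ?_ ?_
  · nlinarith [norm_nonneg e, abs_nonneg P.γ]
  · refine (pi_norm_le_iff_of_nonneg (by positivity)).2 fun i => ?_
    have he : |e i| ≤ ‖e‖ := by rw [← Real.norm_eq_abs]; exact norm_le_pi_norm e i
    have hw0 : 0 ≤ bathWeight N i := by unfold bathWeight; split_ifs <;> norm_num
    have hw2 : bathWeight N i ≤ 2 := by unfold bathWeight; split_ifs <;> norm_num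
    rw [Real.norm_eq_abs, abs_neg, abs_mul, abs_mul, abs_of_nonneg hw0]
    calc |P.γ| * bathWeight N i * |e i| ≤ |P.γ| * 2 * ‖e‖ := by
          gcongr
      _ ≤ (1 + 2 * |P.γ|) * ‖e‖ := by nlinarith [norm_nonneg e, abs_nonneg P.γ]

/-- **The energy identity, lower bound**: `-DH(y)·Y(y + (0, e)) ≤ ‖e‖(∑|∂_{q_i}H| + 2γ∑|p_i|) +
2γ ∑_i p_i²` (the dissipation `γ ∑_b w_b p_b²` is at most `2γ ∑ p_i²`; `γ ≥ 0`).
[cite: CuneoEckmannHairerReyBellet2018, §3 eq. (3.3)] -/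
theorem neg_fderiv_hamiltonian_drift_le (hH : Differentiable ℝ (P.hamiltonian N)) (hγ : 0 ≤ P.γ)
    (y : PhaseSpace N) (e : Fin N → ℝ) :
    -(fderiv ℝ (P.hamiltonian N) y (P.drift N (y.1, y.2 + e))) ≤
      ‖e‖ * ((∑ i, |partialQ i (P.hamiltonian N) y|) + 2 * P.γ * ∑ i, |y.2 i|) +
        2 * P.γ * ∑ i, y.2 i ^ 2 := by
  rw [P.fderiv_hamiltonian_apply hH]
  simp only [drift, P.partialQ_hamiltonian_fst, Pi.add_apply]
  have hr : ‖e‖ * ((∑ i, |partialQ i (P.hamiltonian N) y|) + 2 * P.γ * ∑ i, |y.2 i|) +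
      2 * P.γ * ∑ i, y.2 i ^ 2 =
      ∑ i, (‖e‖ * |partialQ i (P.hamiltonian N) y| + ‖e‖ * 2 * P.γ * |y.2 i| +
        2 * P.γ * y.2 i ^ 2) := by
    rw [mul_add, Finset.mul_sum, Finset.mul_sum, Finset.mul_sum, Finset.mul_sum,
      ← Finset.sum_add_distrib, ← Finset.sum_add_distrib]
    exact Finset.sum_congr rfl fun i _ => by ring
  rw [hr, ← Finset.sum_neg_distrib]
  refine Finset.sum_le_sum fun i _ => ?_
  set a := partialQ i (P.hamiltonian N) y
  set p := y.2 i
  have he : |e i| ≤ ‖e‖ := by rw [← Real.norm_eq_abs]; exact norm_le_pi_norm e i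
  have hw0 : 0 ≤ bathWeight N i := by unfold bathWeight; split_ifs <;> norm_num
  have hw2 : bathWeight N i ≤ 2 := by unfold bathWeight; split_ifs <;> norm_num
  have h1 : -(a * e i) ≤ ‖e‖ * |a| := by
    calc -(a * e i) ≤ |a * e i| := neg_le_abs _
      _ = |a| * |e i| := abs_mul _ _
      _ ≤ |a| * ‖e‖ := mul_le_mul_of_nonneg_left he (abs_nonneg _)
      _ = ‖e‖ * |a| := mul_comm _ _
  have h2 : P.γ * bathWeight N i * p * p ≤ 2 * P.γ * p ^ 2 := by
    have : P.γ * bathWeight N i * (p * p) ≤ P.γ * 2 * (p * p) :=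
      mul_le_mul_of_nonneg_right (mul_le_mul_of_nonneg_left hw2 hγ) (mul_self_nonneg p)
    nlinarith
  have h3 : P.γ * bathWeight N i * p * e i ≤ ‖e‖ * 2 * P.γ * |p| := by
    calc P.γ * bathWeight N i * p * e i ≤ |P.γ * bathWeight N i * p * e i| := le_abs_self _
      _ = P.γ * bathWeight N i * (|p| * |e i|) := by
          rw [abs_mul, abs_mul, abs_mul, abs_of_nonneg hγ, abs_of_nonneg hw0]; ring
      _ ≤ P.γ * 2 * (|p| * ‖e‖) := by
          refine mul_le_mul (mul_le_mul_of_nonneg_left hw2 hγ)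
            (mul_le_mul_of_nonneg_left he (abs_nonneg _)) (by positivity) (by positivity)
      _ = ‖e‖ * 2 * P.γ * |p| := by ring
  calc -(a * (p + e i) + p * (-a - P.γ * bathWeight N i * (p + e i)))
      = -(a * e i) + P.γ * bathWeight N i * p * p + P.γ * bathWeight N i * p * e i := by ring
    _ ≤ ‖e‖ * |a| + 2 * P.γ * p ^ 2 + ‖e‖ * 2 * P.γ * |p| := add_le_add (add_le_add h1 h2) h3
    _ = ‖e‖ * |a| + ‖e‖ * 2 * P.γ * |p| + 2 * P.γ * p ^ 2 := by ring

end OscillatorChain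


/-! ### Two-sided energy bounds along the flow of the pinned chain -/

section Pinned

variable {ω₂ lam β γ : ℝ} (hω : 0 < ω₂) (hl : 0 ≤ lam) (hβ : 0 ≤ β) (hγ : 0 ≤ γ) (N : ℕ)
include hω hl hβ hγ

omit hγ in
/-- `∑ p_i² ≤ 2H` for the pinned chain (`U, V ≥ 0`; `ω₂ ≥ 0`). [folklore] -/
theorem pinnedChain_sum_sq_le_two_mul_hamiltonian (x : PhaseSpace N) :
    ∑ i, x.2 i ^ 2 ≤ 2 * (pinnedChain ω₂ lam β γ).hamiltonian N x := by
  have h := pinnedChain_harmonic_le_hamiltonian (ω₂ := ω₂) hl hβ γ N x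
  have h1 : 0 ≤ ∑ i, ω₂ * x.1 i ^ 2 / 2 := Finset.sum_nonneg fun i _ => by positivity
  have h2 : ∑ i, x.2 i ^ 2 = 2 * ∑ i, x.2 i ^ 2 / 2 := by rw [Finset.mul_sum]; ring_nf
  linarith

/-- **Lower linear energy bound**: `-DH(y)·Y(y + (0,e)) ≤ (C ‖e‖ + 4γ)(1 + H(y))` with
`C = pinnedChainEnergyConst`. [folklore] -/
theorem pinnedChain_neg_fderiv_hamiltonian_drift_le (y : PhaseSpace N) (e : Fin N → ℝ) :
    -(fderiv ℝ ((pinnedChain ω₂ lam β γ).hamiltonian N) y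
        ((pinnedChain ω₂ lam β γ).drift N (y.1, y.2 + e))) ≤
      (pinnedChainEnergyConst ω₂ lam β γ N * ‖e‖ + 4 * γ) *
        (1 + (pinnedChain ω₂ lam β γ).hamiltonian N y) := by
  set P := pinnedChain ω₂ lam β γ
  have hHd : Differentiable ℝ (P.hamiltonian N) :=
    (pinnedChain_contDiff_hamiltonian ω₂ lam β γ N).differentiable one_ne_zero
  have hγ' : 0 ≤ P.γ := hγ
  have h1 := P.neg_fderiv_hamiltonian_drift_le hHd hγ' y e
  have h2 := pinnedChain_linearEnergyBound hω hl hβ hγ N y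
  have h3 := pinnedChain_sum_sq_le_two_mul_hamiltonian hω hl hβ N (γ := γ) y
  have hH0 := pinnedChain_hamiltonian_nonneg hω.le hl hβ γ N y
  have h4 : ‖e‖ * ((∑ i, |partialQ i (P.hamiltonian N) y|) + 2 * P.γ * ∑ i, |y.2 i|) ≤
      ‖e‖ * (pinnedChainEnergyConst ω₂ lam β γ N * (1 + P.hamiltonian N y)) :=
    mul_le_mul_of_nonneg_left h2 (norm_nonneg e)
  have h5 : 2 * P.γ * ∑ i, y.2 i ^ 2 ≤ 4 * γ * (1 + P.hamiltonian N y) := by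
    show 2 * γ * ∑ i, y.2 i ^ 2 ≤ 4 * γ * (1 + P.hamiltonian N y)
    nlinarith [mul_le_mul_of_nonneg_left h3 hγ]
  calc -(fderiv ℝ (P.hamiltonian N) y (P.drift N (y.1, y.2 + e)))
      ≤ ‖e‖ * ((∑ i, |partialQ i (P.hamiltonian N) y|) + 2 * P.γ * ∑ i, |y.2 i|) +
          2 * P.γ * ∑ i, y.2 i ^ 2 := h1
    _ ≤ ‖e‖ * (pinnedChainEnergyConst ω₂ lam β γ N * (1 + P.hamiltonian N y)) +
          4 * γ * (1 + P.hamiltonian N y) := add_le_add h4 h5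
    _ = _ := by ring

/-- **The energy is at most exponentially DEcreasing along the flow**: for the flow
`z = chainFlow x η` of the pinned chain driven by a continuous noise path with `‖η‖ ≤ M` on
`[0, T]` and `y = z - (0, η)` its differentiable part,
`(1 + H(x)) e^{-(C M + 4γ) t} ≤ 1 + H(y(t))` on `[0, T]` (Grönwall for `-(1 + H∘y)`, whose
derivative is `-DH(y)·Y(y + (0,η)) ≤ (C‖η‖ + 4γ)(1 + H∘y)`). The companion upper bound
`1 + H(y(t)) ≤ (1 + H(x)) e^{C M t}` is `pinnedChain_hamiltonian_chainFlow_le`. [folklore] -/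
theorem pinnedChain_le_hamiltonian_chainFlow (x : PhaseSpace N) {η : ℝ → Fin N → ℝ}
    (hη : Continuous η) {T M : ℝ} (hM : ∀ t ∈ Icc 0 T, ‖η t‖ ≤ M) :
    ∀ t ∈ Icc 0 T, (1 + (pinnedChain ω₂ lam β γ).hamiltonian N x) *
        Real.exp (-(pinnedChainEnergyConst ω₂ lam β γ N * M + 4 * γ) * t) ≤
      1 + (pinnedChain ω₂ lam β γ).hamiltonian N
        ((pinnedChain ω₂ lam β γ).chainFlow N x η t - ((0 : Fin N → ℝ), η t)) := by
  intro t ht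
  set P := pinnedChain ω₂ lam β γ with hP
  set H := P.hamiltonian N with hHdef
  set Y := P.drift N with hYdef
  set z := P.chainFlow N x η with hzdef
  set C := pinnedChainEnergyConst ω₂ lam β γ N with hCdef
  set Λ := C * M + 4 * γ with hΛ
  have hT : 0 ≤ T := ht.1.trans ht.2
  have hM0 : 0 ≤ M := (norm_nonneg _).trans (hM 0 ⟨le_rfl, hT⟩)
  have hC0 : 0 ≤ C := pinnedChainEnergyConst_nonneg hω hl hβ γ N
  have hYc : Continuous Y := (pinnedChain_contDiff_drift ω₂ lam β γ N (n := 0)).continuous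
  have hzc : Continuous z := pinnedChain_continuous_chainFlow hω hl hβ hγ N x hη
  have hz_eq : ∀ s ∈ Icc 0 T, z s = forcing x η s + ∫ r in (0 : ℝ)..s, Y (z r) :=
    pinnedChain_isIntegralSolutionOn_chainFlow hω hl hβ hγ N x hη T
  have hHs : ContDiff ℝ 1 H := pinnedChain_contDiff_hamiltonian ω₂ lam β γ N
  have hHd : Differentiable ℝ H := hHs.differentiable one_ne_zero
  -- `y(t) = x + ∫₀ᵗ Y(z)`, `y' = Y(z)`, `y = z - (0, η)` on `[0, T]`
  set y : ℝ → PhaseSpace N := fun s => x + ∫ r in (0 : ℝ)..s, Y (z r) with hydef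
  have hy_deriv : ∀ s, HasDerivAt y (Y (z s)) s := fun s => by
    have h1 : HasDerivAt (fun u => ∫ r in (0 : ℝ)..u, Y (z r)) (Y (z s)) s :=
      ((hYc.comp hzc).integral_hasStrictDerivAt 0 s).hasDerivAt
    exact h1.const_add x
  have hy_eq : ∀ s ∈ Icc 0 T, y s = z s - ((0 : Fin N → ℝ), η s) := fun s hs => by
    rw [hz_eq s hs]
    simp only [hydef, forcing]
    abel
  have hz_y : ∀ s ∈ Icc 0 T, z s = ((y s).1, (y s).2 + η s) := fun s hs => by
    rw [hy_eq s hs]; ext i <;> simp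
  -- Grönwall for `f = -(1 + H∘y)`
  set f : ℝ → ℝ := fun s => -(1 + H (y s)) with hfdef
  have hf_deriv : ∀ s, HasDerivAt f (-(fderiv ℝ H (y s) (Y (z s)))) s := fun s =>
    (((hHd (y s)).hasFDerivAt.comp_hasDerivAt s (hy_deriv s)).const_add 1).neg
  have hf_cont : Continuous f := continuous_iff_continuousAt.2 fun s => (hf_deriv s).continuousAt
  have hbound : ∀ s ∈ Ico 0 T, -(fderiv ℝ H (y s) (Y (z s))) ≤ (-Λ) * f s + 0 := by
    intro s hs
    have hs' : s ∈ Icc 0 T := ⟨hs.1, hs.2.le⟩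
    rw [hz_y s hs']
    have h := pinnedChain_neg_fderiv_hamiltonian_drift_le hω hl hβ hγ N (y s) (η s)
    have hH0 : 0 ≤ H (y s) := pinnedChain_hamiltonian_nonneg hω.le hl hβ γ N (y s)
    have hηs : ‖η s‖ ≤ M := hM s hs'
    have hle : (C * ‖η s‖ + 4 * γ) * (1 + H (y s)) ≤ Λ * (1 + H (y s)) := by
      refine mul_le_mul_of_nonneg_right ?_ (by linarith)
      nlinarith [mul_le_mul_of_nonneg_left hηs hC0]
    calc -(fderiv ℝ H (y s) (Y ((y s).1, (y s).2 + η s))) ≤ (C * ‖η s‖ + 4 * γ) * (1 + H (y s)) := h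
      _ ≤ Λ * (1 + H (y s)) := hle
      _ = (-Λ) * f s + 0 := by simp only [hfdef]; ring
  have hf0 : f 0 ≤ -(1 + H x) := by simp [hfdef, hydef]
  have hG := le_gronwallBound_of_liminf_deriv_right_le (f := f)
    (f' := fun s => -(fderiv ℝ H (y s) (Y (z s)))) (δ := -(1 + H x)) (K := -Λ) (ε := 0) (a := 0)
    (b := T) hf_cont.continuousOn (fun s _ r hr => ?_) hf0 hbound t ht
  · rw [sub_zero, gronwallBound_ε0] at hG
    have hfin : f t = -(1 + H (z t - ((0 : Fin N → ℝ), η t))) := by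
      show -(1 + H (y t)) = _
      rw [hy_eq t ht]
    rw [hfin] at hG
    have : (1 + H x) * Real.exp (-Λ * t) ≤ 1 + H (z t - ((0 : Fin N → ℝ), η t)) := by linarith
    simpa [hΛ, hCdef] using this
  · have := ((hf_deriv s).hasDerivWithinAt (s := Ici s)).liminf_right_slope_le hr
    refine this.mono fun w hw => ?_
    rwa [slope_def_field, div_eq_inv_mul] at hw

/-- **The energy grows at most exponentially along the flow** (the bound of
`pinnedChain_hamiltonian_truncSol_le`, transported to `chainFlow`):
`1 + H(z(t) - (0, η(t))) ≤ (1 + H(x)) e^{C M t}` on `[0, T]`. [cite: CuneoEckmannHairerReyBellet2018, §3 p. 7] -/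
theorem pinnedChain_hamiltonian_chainFlow_le (x : PhaseSpace N) {η : ℝ → Fin N → ℝ}
    (hη : Continuous η) {T M : ℝ} (hM : ∀ t ∈ Icc 0 T, ‖η t‖ ≤ M) :
    ∀ t ∈ Icc 0 T, 1 + (pinnedChain ω₂ lam β γ).hamiltonian N
        ((pinnedChain ω₂ lam β γ).chainFlow N x η t - ((0 : Fin N → ℝ), η t)) ≤
      (1 + (pinnedChain ω₂ lam β γ).hamiltonian N x) *
        Real.exp (pinnedChainEnergyConst ω₂ lam β γ N * M * t) := by
  intro t ht
  set R := max (pinnedChainRadius ω₂ lam β γ N ((pinnedChain ω₂ lam β γ).hamiltonian N x) M T) 1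
  have hR : 0 < R := lt_max_of_lt_right one_pos
  rw [pinnedChain_chainFlow_eqOn_truncSol hω hl hβ hγ N hR x hη hM (le_max_left _ _) ht]
  exact pinnedChain_hamiltonian_truncSol_le hω hl hβ hγ N hR x hη hM t ht

end Pinned


/-! ### Local increment bounds and the far region -/

section Increments

variable {ω₂ lam β γ : ℝ} (hω : 0 < ω₂) (hl : 0 ≤ lam) (hβ : 0 ≤ β) (hγ : 0 ≤ γ) (N : ℕ)
include hω hl hβ hγ

omit hγ in
/-- The a-priori radius is monotone in all of `(E₀, M, T)` (`1 + E₀ ≥ 0`, `M, T ≥ 0`).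
[folklore] -/
theorem pinnedChainRadius_mono₃ {E₀ E₀' M M' T T' : ℝ} (hE : 0 ≤ 1 + E₀) (hEE : E₀ ≤ E₀')
    (hM : 0 ≤ M) (hMM : M ≤ M') (hT : 0 ≤ T) (hTT : T ≤ T') :
    pinnedChainRadius ω₂ lam β γ N E₀ M T ≤ pinnedChainRadius ω₂ lam β γ N E₀' M' T' := by
  unfold pinnedChainRadius
  have hC := pinnedChainEnergyConst_nonneg hω hl hβ γ N
  refine add_le_add (pinnedChainSublevelRadius_mono hω ?_) hMM
  have h1 : Real.exp (pinnedChainEnergyConst ω₂ lam β γ N * M * T) ≤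
      Real.exp (pinnedChainEnergyConst ω₂ lam β γ N * M' * T') :=
    Real.exp_le_exp.2 (mul_le_mul (mul_le_mul_of_nonneg_left hMM hC) hTT hT
      (mul_nonneg hC (hM.trans hMM)))
  have h2 := mul_le_mul (by linarith : 1 + E₀ ≤ 1 + E₀') h1 (Real.exp_pos _).le
    (by linarith : 0 ≤ 1 + E₀')
  linarith

/-- The flow increment without the noise is the time integral of the drift:
`z(t) - x - (0, η(t)) = ∫₀ᵗ Y(z(s)) ds` on `[0, T]`. [folklore] -/
theorem pinnedChain_chainFlow_sub_sub_eq_integral (x : PhaseSpace N) {η : ℝ → Fin N → ℝ}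
    (hη : Continuous η) {T t : ℝ} (ht : t ∈ Icc 0 T) :
    (pinnedChain ω₂ lam β γ).chainFlow N x η t - x - ((0 : Fin N → ℝ), η t) =
      ∫ s in (0 : ℝ)..t, (pinnedChain ω₂ lam β γ).drift N ((pinnedChain ω₂ lam β γ).chainFlow N x η s) := by
  rw [pinnedChain_isIntegralSolutionOn_chainFlow hω hl hβ hγ N x hη T t ht]
  simp only [forcing]
  abel

/-- **Local bounds for the flow started below an energy level.** For every level `E₀ ≥ 0` there
are constants `R₀, Y₁, L₁ ≥ 0` such that for every start `x` with `H(x) ≤ E₀`, every continuous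
noise path with `‖η‖ ≤ M ≤ 1` on `[0, T]`, `T ≤ 1`, and every `t ∈ [0, T]`: the flow stays in
the ball of radius `R₀`; the drift increment `D(t) = z(t) - x - (0, η(t))` has `‖D(t)‖ ≤ t Y₁`;
and `‖D(t) - t Y(x)‖ ≤ L₁ t (M + T Y₁)` (`Y₁` bounds the drift and `L₁` is its Lipschitz constant
on the ball). [folklore] -/
theorem pinnedChain_flow_local_bounds {E₀ : ℝ} (hE₀ : 0 ≤ E₀) :
    ∃ R₀ Y₁ L₁ : ℝ, 0 ≤ R₀ ∧ 0 ≤ Y₁ ∧ 0 ≤ L₁ ∧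
      ∀ x : PhaseSpace N, (pinnedChain ω₂ lam β γ).hamiltonian N x ≤ E₀ →
        ∀ {η : ℝ → Fin N → ℝ}, Continuous η → ∀ {T M : ℝ}, (∀ t ∈ Icc 0 T, ‖η t‖ ≤ M) →
          M ≤ 1 → T ≤ 1 → ∀ t ∈ Icc 0 T,
            ‖(pinnedChain ω₂ lam β γ).chainFlow N x η t‖ ≤ R₀ ∧
            ‖(pinnedChain ω₂ lam β γ).chainFlow N x η t - x - ((0 : Fin N → ℝ), η t)‖ ≤ t * Y₁ ∧
            ‖(pinnedChain ω₂ lam β γ).chainFlow N x η t - x - ((0 : Fin N → ℝ), η t) -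
                t • (pinnedChain ω₂ lam β γ).drift N x‖ ≤ L₁ * t * (M + T * Y₁) := by
  set P := pinnedChain ω₂ lam β γ with hP
  set R₀ := pinnedChainRadius ω₂ lam β γ N E₀ 1 1 with hR₀
  have hYc : ContDiff ℝ 1 (P.drift N) := pinnedChain_contDiff_drift ω₂ lam β γ N
  obtain ⟨Y₁', hY₁'⟩ := (isCompact_closedBall (0 : PhaseSpace N) R₀).exists_bound_of_continuousOn
    hYc.continuous.continuousOn
  set Y₁ := max Y₁' 0 with hY₁
  obtain ⟨L₁, hL₁⟩ := exists_lipschitzOnWith_closedBall hYc R₀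
  have hρ : ∀ {x : PhaseSpace N}, P.hamiltonian N x ≤ E₀ → ‖x‖ ≤ R₀ := fun {x} hx => by
    refine (pinnedChain_norm_le_sublevelRadius hω hl hβ γ N hx).trans ?_
    rw [hR₀, pinnedChainRadius]
    refine le_add_of_le_of_nonneg (pinnedChainSublevelRadius_mono hω ?_) zero_le_one
    have hC := pinnedChainEnergyConst_nonneg hω hl hβ γ N
    have : 1 ≤ Real.exp (pinnedChainEnergyConst ω₂ lam β γ N * 1 * 1) := Real.one_le_exp (by simpa)
    nlinarith
  have hR₀0 : 0 ≤ R₀ := add_nonneg (pinnedChainSublevelRadius_nonneg _ _) zero_le_one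
  refine ⟨R₀, Y₁, L₁, hR₀0, le_max_right _ _, L₁.2, fun x hx η hη T M hM hM1 hT1 t ht => ?_⟩
  have hT : 0 ≤ T := ht.1.trans ht.2
  have hM0 : 0 ≤ M := (norm_nonneg _).trans (hM 0 ⟨le_rfl, hT⟩)
  -- the flow stays in the ball of radius `R₀`
  have hball : ∀ s ∈ Icc 0 T, ‖P.chainFlow N x η s‖ ≤ R₀ := fun s hs =>
    (pinnedChain_norm_chainFlow_le hω hl hβ hγ N x hη hM s hs).trans
      (pinnedChainRadius_mono₃ hω hl hβ N (by linarith [pinnedChain_hamiltonian_nonneg hω.le hl hβ γ N x])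
        hx hM0 hM1 hT hT1)
  have hYb : ∀ s ∈ Icc 0 T, ‖P.drift N (P.chainFlow N x η s)‖ ≤ Y₁ := fun s hs =>
    (hY₁' _ (mem_closedBall_zero_iff.2 (hball s hs))).trans (le_max_left _ _)
  have hcont : Continuous fun s => P.drift N (P.chainFlow N x η s) :=
    hYc.continuous.comp (pinnedChain_continuous_chainFlow hω hl hβ hγ N x hη)
  have hD : P.chainFlow N x η t - x - ((0 : Fin N → ℝ), η t) =
      ∫ s in (0 : ℝ)..t, P.drift N (P.chainFlow N x η s) :=
    pinnedChain_chainFlow_sub_sub_eq_integral hω hl hβ hγ N x hη ht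
  have hDs : ∀ s ∈ Icc 0 T, ‖P.chainFlow N x η s - x - ((0 : Fin N → ℝ), η s)‖ ≤ s * Y₁ := by
    intro s hs
    rw [pinnedChain_chainFlow_sub_sub_eq_integral hω hl hβ hγ N x hη hs]
    have h := intervalIntegral.norm_integral_le_of_norm_le_const (a := 0) (b := s) (C := Y₁)
      (f := fun r => P.drift N (P.chainFlow N x η r)) fun r hr => ?_
    · calc ‖∫ r in (0 : ℝ)..s, P.drift N (P.chainFlow N x η r)‖ ≤ Y₁ * |s - 0| := h
        _ = s * Y₁ := by rw [sub_zero, abs_of_nonneg hs.1, mul_comm]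
    · rw [uIoc_of_le hs.1] at hr
      exact hYb r ⟨hr.1.le, hr.2.trans hs.2⟩
  refine ⟨hball t ht, hDs t ht, ?_⟩
  -- `D(t) - t Y(x) = ∫₀ᵗ (Y(z(s)) - Y(x)) ds`, `‖Y(z(s)) - Y(x)‖ ≤ L₁ (M + T Y₁)`
  have hx0 : ‖x‖ ≤ R₀ := hρ hx
  have hdiff : ∀ s ∈ Icc 0 T, ‖P.drift N (P.chainFlow N x η s) - P.drift N x‖ ≤ L₁ * (M + T * Y₁) := by
    intro s hs
    have h1 := hL₁.norm_sub_le (mem_closedBall_zero_iff.2 (hball s hs)) (mem_closedBall_zero_iff.2 hx0)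
    refine h1.trans (mul_le_mul_of_nonneg_left ?_ L₁.2)
    calc ‖P.chainFlow N x η s - x‖
        = ‖(P.chainFlow N x η s - x - ((0 : Fin N → ℝ), η s)) + ((0 : Fin N → ℝ), η s)‖ := by
          rw [sub_add_cancel]
      _ ≤ ‖P.chainFlow N x η s - x - ((0 : Fin N → ℝ), η s)‖ + ‖((0 : Fin N → ℝ), η s)‖ :=
          norm_add_le _ _
      _ ≤ s * Y₁ + M := add_le_add (hDs s hs) (by rw [Prod.norm_def]; simp [hM s hs])
      _ ≤ M + T * Y₁ := by nlinarith [hs.2, le_max_right Y₁' 0]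
  have heq : P.chainFlow N x η t - x - ((0 : Fin N → ℝ), η t) - t • P.drift N x =
      ∫ s in (0 : ℝ)..t, (P.drift N (P.chainFlow N x η s) - P.drift N x) := by
    rw [hD, intervalIntegral.integral_sub (hcont.intervalIntegrable _ _) intervalIntegrable_const,
      intervalIntegral.integral_const, sub_zero]
  rw [heq]
  have h := intervalIntegral.norm_integral_le_of_norm_le_const (a := 0) (b := t) (C := L₁ * (M + T * Y₁))
    (f := fun s => P.drift N (P.chainFlow N x η s) - P.drift N x) fun s hs => ?_
  · calc ‖∫ s in (0 : ℝ)..t, (P.drift N (P.chainFlow N x η s) - P.drift N x)‖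
        ≤ L₁ * (M + T * Y₁) * |t - 0| := h
      _ = L₁ * t * (M + T * Y₁) := by rw [sub_zero, abs_of_nonneg ht.1]; ring
  · rw [uIoc_of_le ht.1] at hs
    exact hdiff s ⟨hs.1.le, hs.2.trans ht.2⟩

/-- **The far region.** For every energy level `E_K` there is a level `E₁` such that the flow
started at `H(x) > E₁` and driven by a continuous noise path with `‖η‖ ≤ M ≤ 1/2` on `[0, T]`,
`T ≤ 1`, stays STRICTLY ABOVE the level `E_K` on `[0, T]` (the energy decreases at most
exponentially, `pinnedChain_le_hamiltonian_chainFlow`, and adding back the noise momentum costs at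
most `M(N/2 + H)`). [folklore] -/
theorem pinnedChain_flow_far (E_K : ℝ) :
    ∃ E₁ : ℝ, 0 ≤ E₁ ∧ ∀ x : PhaseSpace N, E₁ < (pinnedChain ω₂ lam β γ).hamiltonian N x →
      ∀ {η : ℝ → Fin N → ℝ}, Continuous η → ∀ {T M : ℝ}, (∀ t ∈ Icc 0 T, ‖η t‖ ≤ M) →
        M ≤ 1 / 2 → T ≤ 1 → ∀ t ∈ Icc 0 T,
          E_K < (pinnedChain ω₂ lam β γ).hamiltonian N ((pinnedChain ω₂ lam β γ).chainFlow N x η t) := by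
  set P := pinnedChain ω₂ lam β γ with hP
  set C := pinnedChainEnergyConst ω₂ lam β γ N with hC
  set Λ₀ := C / 2 + 4 * γ with hΛ₀
  have hC0 : 0 ≤ C := pinnedChainEnergyConst_nonneg hω hl hβ γ N
  set E₁ := max 0 ((2 * |E_K| + N / 2 + 1) * Real.exp Λ₀) with hE₁
  refine ⟨E₁, le_max_left _ _, fun x hx η hη T M hM hM2 hT1 t ht => ?_⟩
  have hT : 0 ≤ T := ht.1.trans ht.2
  have hM0 : 0 ≤ M := (norm_nonneg _).trans (hM 0 ⟨le_rfl, hT⟩)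
  set y := P.chainFlow N x η t - ((0 : Fin N → ℝ), η t) with hy
  have hz : P.chainFlow N x η t = (y.1, y.2 + η t) := by ext i <;> simp [hy]
  -- lower energy bound along the differentiable part
  have hlow := pinnedChain_le_hamiltonian_chainFlow hω hl hβ hγ N x hη hM t ht
  have hexp : Real.exp (-Λ₀) ≤ Real.exp (-(C * M + 4 * γ) * t) := by
    refine Real.exp_le_exp.2 ?_
    have h1 : (C * M + 4 * γ) * t ≤ Λ₀ := by
      have : C * M + 4 * γ ≤ Λ₀ := by rw [hΛ₀]; nlinarith
      calc (C * M + 4 * γ) * t ≤ (C * M + 4 * γ) * 1 :=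
            mul_le_mul_of_nonneg_left (ht.2.trans hT1) (by positivity)
        _ ≤ Λ₀ := by linarith
    linarith
  have hHx := pinnedChain_hamiltonian_nonneg hω.le hl hβ γ N x
  have hHy := pinnedChain_hamiltonian_nonneg hω.le hl hβ γ N y
  have h1 : (1 + P.hamiltonian N x) * Real.exp (-Λ₀) ≤ 1 + P.hamiltonian N y :=
    (mul_le_mul_of_nonneg_left hexp (by linarith)).trans hlow
  -- adding back the noise momentum
  have h2 : P.hamiltonian N y - M * (N / 2 + P.hamiltonian N y) ≤ P.hamiltonian N (P.chainFlow N x η t) := by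
    rw [hz]
    refine le_trans ?_ (P.hamiltonian_sub_le_hamiltonian_add_momentum N y (η t))
    have hs := pinnedChain_sum_abs_momentum_le hω.le hl hβ γ N y
    nlinarith [mul_le_mul (hM t ht) hs (Finset.sum_nonneg fun i _ => abs_nonneg (y.2 i)) hM0]
  -- `E₁ < H(x)` and the choice of `E₁`
  have h3 : (2 * |E_K| + N / 2 + 1) * Real.exp Λ₀ < P.hamiltonian N x := (le_max_right _ _).trans_lt hx
  have h4 : 2 * |E_K| + N / 2 + 1 < (1 + P.hamiltonian N x) * Real.exp (-Λ₀) := by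
    rw [Real.exp_neg]
    rw [lt_mul_inv_iff₀ (Real.exp_pos Λ₀)]
    nlinarith [Real.exp_pos Λ₀]
  have hEK : E_K ≤ |E_K| := le_abs_self _
  have h5 : M * (N / 2 + P.hamiltonian N y) ≤ 1 / 2 * (N / 2 + P.hamiltonian N y) :=
    mul_le_mul_of_nonneg_right hM2 (by positivity)
  linarith

end Increments


end Literature.MathematicalPhysics.KineticTheory.HeatConduction
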